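import Literature.Barriers.Parity.SelbergParity
import Literature.NumberTheory.Sieve.ParityBarrierSelbergProofs
import HarnessLib

/-!
# `SelbergParity` — companion ("Proofs") file: discharge of `Literature.Barriers.Parity.SelbergParityBarrier`

Topic `Literature/Barriers/Parity`, companion of the catalogue entry `SelbergParity.lean`
(Selberg's parity barrier, D-0021), kept separate so that the statement file and its light import
graph are unchanged: the proof needs the prime number theorem for Liouville's function with a
saving of every power of `log` (`Literature.NumberTheory.LFunctions.abs_sum_liouville_le_logPow`,
`Literature/NumberTheory/LFunctions/LiouvilleSumClassicalBound.lean`, PROVED in the tree from the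
classical zero-free region of `ζ`), imported here through
`Literature/NumberTheory/Sieve/ParityBarrierSelbergProofs.lean`. All declarations in this file
are PROVED theorems; no new definitions.

* `SelbergParityBarrier_holds : SelbergParityBarrier` — Ford's assertion (Trans. AMS 357 (2005),
  §1, arXiv p. 3): Selberg's `a_n = 1 + λ(n)` with `A(x) = x`, `g(d) = 1/d` satisfies `R(ν)`
  for ALL `ν < 1`, i.e. `∑_{d ≤ x^ν} |A_d(x) − x/d| ≪_{ν,B} x (log x)^{−B}` for every `B > 0`.
  Proof (the source asserts it without proof; p. 5, Lemma 2.1: "The only analytic tool we require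
  is the Prime Number Theorem with the de la Vallée Poussin error term"): by complete
  multiplicativity `A_d(x) = ⌊x/d⌋ + λ(d) L(⌊x⌋/d)`, `L(y) = ∑_{m ≤ y} λ(m)`, so
  `|A_d(x) − x/d| ≤ 1 + |L(⌊x⌋/d)|` (tree: `Literature.NumberTheory.Sieve.abs_remainder_le_of_liouvilleTwist`, applied to
  the sifted sequence `Literature.selbergParitySeq 1` whose remainder `R_d(x)` is literally this term);
  and for `d ≤ x^ν`, `x/d ≥ x^{1−ν}`, the prime number theorem for `λ` with saving
  `(log y)^{−B−1}` gives `∑_{d ≤ x^ν} (1 + |L(⌊x⌋/d)|) ≤ x^ν + C x ((1−ν) log x)^{−B−1} (1 + log x)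
  ≤ C' x (log x)^{−B}` for large `x` (tree: `Literature.NumberTheory.Sieve.eventually_sum_level_le`, stated for every real
  `θ' < 1`, hence covering the trivial range `ν ≤ 0` as well).
* the unconditional form of the consequence proved in `SelbergParity.lean` from the named fact:
  `no_typeI_prime_lower_bound_allModuli_holds` (no functional of level-`x^ν` all-moduli Type-I
  data bounds the prime mass of a non-negative sequence from below, any `ν < 1`). (The tree-layer
  consequences `SelbergParityBarrier.parity_barrier_typeI`, `.no_typeI_prime_lower_bound` fed
  with `SelbergParityBarrier_holds` and `Literature.NumberTheory.Sieve.hasSieveDimension_reciprocalDensity_one_holds`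
  coincide with the tree's `Literature.NumberTheory.Sieve.parity_barrier_typeI_holds`, `Literature.NumberTheory.Sieve.no_typeI_prime_lower_bound_holds`
  of `ParityBarrierSelbergProofs.lean` and are not restated.)
* `SelbergParityBarrier.isBigO_sum_liouville` — conversely, already the case `ν = 0` (the single
  modulus `d = 1`) of the fact returns the prime number theorem for `λ` with every log-power
  saving, `L(x) ≪_B x (log x)^{−B}`: the fact is exactly as strong as its analytic input, which is
  why it could not be discharged from Mathlib alone.
* `selbergParity_not_parityCondition`, `selbergParity_not_hooleyCondition` (barrier audit
  2026-08-16, D-0021; the EDGE of the technique class) — the witness `1 + λ(n)` has a global parity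
  bias: `P(x) = ∑_{n ≤ x} (1 + λ(n)) μ(n) = 2 #{n ≤ x : μ(n) = 1} ≥ 2(π(x/2) − 1)`
  (`two_mul_primeCounting_sub_one_le_sum`; each `2p` contributes `2`), so by Chebyshev it violates
  Ford's linear parity axiom `(Pcond)` `P(x) ≪_B x (log x)^{−B}` and Hooley's averaged form at every
  level `α ≥ 0` (p. 4 of the arXiv version). Hence the barrier covers deductions from Type-I data
  ALONE; Type-I data together with a linear Möbius-orthogonality axiom is not defeated by this
  witness (nor by any `1 + tλ`, `t ≠ 0`): `μ`-twisted Type-I data are the principal EVASION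
  recorded in `evasions_known` of `SelbergParityBarrier` (audit of the statement file, same day:
  Harman §14.1; at level `min(ν, α) > 2/3` the odd square-free part sifted to `x^{1/3}` yields a
  positive prime lower bound), while for the ASYMPTOTICS `(S_k)` Ford's Theorem-2 sequences satisfy
  `R(ν) ∧ (Pcond)` at fixed `ν` and fail `(S_k)` for all `k ≥ 2` ("the case `α + ν > 1` remains
  open").

## References

* K. Ford, *On Bombieri's asymptotic sieve*, Trans. AMS 357 (2005), 1663–1674, §1 (arXiv
  math/0401215, read pp. 3 and 5) [Ford2004].
* A. Selberg, *On elementary methods in primenumber-theory and their limitations*, 11. Skand.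
  Mat. Kongress Trondheim 1949 (1952), 13–22 [Selberg1952Limitations] (not held; via Ford §1).
* H. L. Montgomery, R. C. Vaughan, *Multiplicative Number Theory I*, CUP 2007, §6.2 (6.17) and
  §6.2.1 Exercise 11 (b)–(c) (the prime number theorem for `λ`; read at PDF p. 146)
  [MontgomeryVaughan2007].
-/

noncomputable section

open Filter Asymptotics Finset ArithmeticFunction
open scoped ArithmeticFunction.Moebius

namespace Literature.Barriers.Parity

/-- The Type-I term of `SelbergParityBarrier` at the modulus `d` is the remainder `R_d(x)` of the
tree's sifted sequence `selbergParitySeq 1` (`a_n = 1 + λ(n)`, `X(x) = x`, `g(d) = 1/d`).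
[folklore] -/
theorem abs_typeI_term_eq_abs_remainder (d : ℕ) (x : ℝ) :
    |(∑ n ∈ (Ioc 0 ⌊x⌋₊).filter (d ∣ ·), (1 + (liouville n : ℝ))) - x / d| =
      |(Literature.NumberTheory.Sieve.selbergParitySeq 1).remainder d x| := by
  simp only [Literature.NumberTheory.Sieve.SieveSequence.remainder, Literature.NumberTheory.Sieve.SieveSequence.congrSum, Literature.NumberTheory.Sieve.selbergParitySeq_a, Units.val_one,
    Int.cast_one, one_mul, Literature.NumberTheory.Sieve.selbergParitySeq_size, Literature.NumberTheory.Sieve.selbergParitySeq_density,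
    Literature.NumberTheory.Sieve.reciprocalDensity_apply, div_eq_mul_inv, mul_comm x]

/-- For `d ≥ 1` and `x ≥ 0`: `|A_d(x) − x/d| ≤ 1 + |L(⌊x⌋/d)|` for Selberg's `a_n = 1 + λ(n)`,
where `L(y) = ∑_{m ≤ y} λ(m)` — since `A_d(x) = ⌊x/d⌋ + λ(d) L(⌊x⌋/d)` by complete
multiplicativity of `λ` (tree: `Literature.NumberTheory.Sieve.abs_remainder_le_of_liouvilleTwist`). [cite: Ford2004, §1] -/
theorem abs_typeI_term_le {d : ℕ} (hd : 0 < d) {x : ℝ} (hx : 0 ≤ x) :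
    |(∑ n ∈ (Ioc 0 ⌊x⌋₊).filter (d ∣ ·), (1 + (liouville n : ℝ))) - x / d| ≤
      1 + |∑ m ∈ Ioc 0 (⌊x⌋₊ / d), (liouville m : ℝ)| := by
  rw [abs_typeI_term_eq_abs_remainder]
  exact Literature.NumberTheory.Sieve.abs_remainder_le_of_liouvilleTwist (Literature.NumberTheory.Sieve.selbergParitySeq 1) (t := (((1 : ℤˣ) : ℤ) : ℝ))
    (by simp) (Literature.NumberTheory.Sieve.selbergParitySeq_a 1) (fun _ => rfl) rfl hd hx

/-- **Discharge of `SelbergParityBarrier`** (Selberg 1949; Ford, Trans. AMS 357 (2005), §1: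
"With `A(x) = x` and `g(d) = 1/d`, `R(ν)` holds for all `ν < 1`"): for every `ν < 1` and
`B > 0`, `∑_{d ≤ x^ν} |∑_{n ≤ x, d ∣ n} (1 + λ(n)) − x/d| = O(x (log x)^{−B})`. From
`abs_typeI_term_le` and the prime number theorem for `λ` in the form
`Literature.NumberTheory.Sieve.eventually_sum_level_le` (`∑_{d ≤ x^ν} (1 + |L(⌊x⌋/d)|) ≤ C x (log x)^{−B}` for large `x`).
[cite: Ford2004, §1] [cite: MontgomeryVaughan2007, §6.2.1 Exercise 11] -/
theorem SelbergParityBarrier_holds : SelbergParityBarrier := by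
  intro ν hν B hB
  obtain ⟨C, hC⟩ := Literature.NumberTheory.Sieve.eventually_sum_level_le (θ' := ν) hν hB
  refine IsBigO.of_bound C ?_
  filter_upwards [hC, eventually_gt_atTop (1 : ℝ)] with x hx hx1
  have hnn : ∀ d : ℕ,
      0 ≤ |(∑ n ∈ (Ioc 0 ⌊x⌋₊).filter (d ∣ ·), (1 + (liouville n : ℝ))) - x / d| :=
    fun d => abs_nonneg _
  rw [Real.norm_of_nonneg (sum_nonneg fun d _ => hnn d),
    Real.norm_of_nonneg (div_nonneg (by linarith) (Real.rpow_nonneg (Real.log_nonneg hx1.le) _))]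
  exact le_trans (sum_le_sum fun d hd => abs_typeI_term_le (mem_Icc.mp hd).1 (by linarith)) hx

/-! ### Unconditional forms of the consequences -/

/-- **No Type-I lower bound for primes, all moduli, unconditionally**: for every `ν < 1` there
is no `c > 0` such that every non-negative sequence with the Type-I data of the integers at level
`x^ν` (all moduli `d ≤ x^ν`, `∑_{d ≤ x^ν} |A_d(x) − x/d| ≪_B x (log x)^{−B}` for all `B`) has prime
mass `∑_{p ≤ x} a_p ≥ c x / log x` for all large `x` (`SelbergParityBarrier_holds` fed into
`SelbergParityBarrier.no_typeI_prime_lower_bound_allModuli`). [cite: Ford2004, §1] -/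
theorem no_typeI_prime_lower_bound_allModuli_holds {ν : ℝ} (hν : ν < 1) :
    ¬ ∃ c : ℝ, 0 < c ∧ ∀ a : ℕ → ℝ, (∀ n, 0 ≤ a n) →
      (∀ B : ℝ, 0 < B →
        (fun x : ℝ => ∑ d ∈ Icc 1 ⌊x ^ ν⌋₊,
            |(∑ n ∈ (Ioc 0 ⌊x⌋₊).filter (d ∣ ·), a n) - x / d|) =O[atTop]
          fun x : ℝ => x / Real.log x ^ B) →
      ∀ᶠ x : ℝ in atTop, c * x / Real.log x ≤ ∑ p ∈ Nat.primesLE ⌊x⌋₊, a p :=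
  SelbergParityBarrier_holds.no_typeI_prime_lower_bound_allModuli hν

/-! ### The fact is as strong as its input: `ν = 0` gives back the prime number theorem for `λ` -/

/-- **`SelbergParityBarrier` at `ν = 0` is the prime number theorem for `λ` with every log-power
saving.** The single modulus `d = 1` of `R(0)` reads `|⌊x⌋ + L(x) − x| ≪_B x (log x)^{−B}`, and
`|⌊x⌋ − x| ≤ 1 ≪ x (log x)^{−B}`; hence `L(x) = ∑_{n ≤ x} λ(n) = O_B(x (log x)^{−B})` for every
`B > 0` (cf. `Literature.NumberTheory.LFunctions.abs_sum_liouville_le_logPow`, the tree's proof of this input from the classical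
zero-free region). [cite: MontgomeryVaughan2007, §6.2.1 Exercise 11] [cite: Ford2004, §1] -/
theorem SelbergParityBarrier.isBigO_sum_liouville (h : SelbergParityBarrier) {B : ℝ}
    (hB : 0 < B) :
    (fun x : ℝ => ∑ n ∈ Ioc 0 ⌊x⌋₊, (liouville n : ℝ)) =O[atTop]
      fun x : ℝ => x / Real.log x ^ B := by
  have h0 := h 0 zero_lt_one B hB
  -- the `d = 1` term of `R(0)`: `|⌊x⌋ + L(x) - x|`
  have h1 : (fun x : ℝ => |(⌊x⌋₊ : ℝ) + (∑ n ∈ Ioc 0 ⌊x⌋₊, (liouville n : ℝ)) - x|) =O[atTop]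
      fun x : ℝ => x / Real.log x ^ B := by
    refine (IsBigO.of_bound 1 ?_).trans h0
    filter_upwards [eventually_ge_atTop (0 : ℝ)] with x hx
    have hIcc : Icc 1 ⌊x ^ (0 : ℝ)⌋₊ = {1} := by
      rw [Real.rpow_zero, Nat.floor_one, Icc_self]
    have hfilter : (Ioc 0 ⌊x⌋₊).filter ((1 : ℕ) ∣ ·) = Ioc 0 ⌊x⌋₊ :=
      filter_true_of_mem fun n _ => one_dvd n
    rw [hIcc, sum_singleton, hfilter, Nat.cast_one, div_one, sum_add_distrib, sum_const,
      Nat.card_Ioc, Nat.sub_zero, nsmul_eq_mul, mul_one, one_mul]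
  -- `|⌊x⌋ - x| ≤ 1 ≪ x / (log x)^B`
  have h2 : (fun x : ℝ => (⌊x⌋₊ : ℝ) - x) =O[atTop] fun x : ℝ => x / Real.log x ^ B := by
    have hlog : (fun x : ℝ => Real.log x ^ B) =o[atTop] fun x : ℝ => x := by
      simpa only [Real.rpow_one] using isLittleO_log_rpow_rpow_atTop B zero_lt_one
    refine IsBigO.of_bound 1 ?_
    filter_upwards [hlog.bound zero_lt_one, eventually_gt_atTop (1 : ℝ)] with x hx hx1
    have hL : 0 < Real.log x ^ B := Real.rpow_pos_of_pos (Real.log_pos hx1) B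
    rw [Real.norm_of_nonneg hL.le, Real.norm_of_nonneg (by linarith : (0 : ℝ) ≤ x), one_mul] at hx
    rw [one_mul, Real.norm_eq_abs, Real.norm_of_nonneg (div_nonneg (by linarith) hL.le),
      le_div_iff₀ hL]
    have hfl : |(⌊x⌋₊ : ℝ) - x| ≤ 1 := by
      rw [abs_le]
      constructor
      · linarith [Nat.lt_floor_add_one x]
      · linarith [Nat.floor_le (by linarith : (0 : ℝ) ≤ x)]
    calc |(⌊x⌋₊ : ℝ) - x| * Real.log x ^ B ≤ 1 * Real.log x ^ B :=
        mul_le_mul_of_nonneg_right hfl hL.le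
      _ ≤ x := by rw [one_mul]; exact hx
  -- `L(x) = (⌊x⌋ + L(x) - x) - (⌊x⌋ - x)`
  have h3 := (h1.of_abs_left).sub h2
  refine h3.congr' (Eventually.of_forall fun x => ?_) EventuallyEq.rfl
  dsimp only
  ring

/-! ### The edge of the technique class: the witness has a global parity bias (Ford's `(Pcond)` fails) -/

/-- Pointwise, `(1 + λ(n)) μ(n) = μ(n) + μ(n)² ≥ 0`: on square-free `n` the Liouville and Möbius
functions agree, elsewhere `μ(n) = 0`. [folklore] -/
theorem one_add_liouville_mul_moebius_nonneg (n : ℕ) :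
    0 ≤ (1 + (liouville n : ℝ)) * (moebius n : ℝ) := by
  rcases eq_or_ne (μ n) 0 with h0 | h0
  · simp [h0]
  · have hsq : Squarefree n := moebius_ne_zero_iff_squarefree.mp h0
    have hn : n ≠ 0 := hsq.ne_zero
    have hlm : (liouville n : ℝ) = (μ n : ℝ) := by
      rw [liouville_apply hn, moebius_apply_of_squarefree hsq]
    rw [hlm]
    rcases moebius_ne_zero_iff_eq_or.mp h0 with h1 | h1 <;> simp [h1]

/-- `(1 + λ(2p)) μ(2p) = 2` for every odd prime `p` (`Ω(2p) = 2`, `μ(2p) = 1`). [folklore] -/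
theorem one_add_liouville_mul_moebius_two_mul_prime {p : ℕ} (hp : p.Prime) (hp2 : p ≠ 2) :
    (1 + (liouville (2 * p) : ℝ)) * (moebius (2 * p) : ℝ) = 2 := by
  have hcop : Nat.Coprime 2 p := (Nat.coprime_primes Nat.prime_two hp).mpr (Ne.symm hp2)
  have hμ : μ (2 * p) = 1 := by
    rw [isMultiplicative_moebius.map_mul_of_coprime hcop, moebius_apply_prime Nat.prime_two,
      moebius_apply_prime hp]
    norm_num
  have hl : liouville (2 * p) = 1 := by
    rw [liouville_apply_mul, liouville_apply two_ne_zero, liouville_apply hp.ne_zero,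
      cardFactors_apply_prime Nat.prime_two, cardFactors_apply_prime hp]
    norm_num
  rw [hμ, hl]
  norm_num

/-- **Global parity bias of Selberg's witness, lower bound.** For every `N`,
`∑_{n ≤ N} (1 + λ(n)) μ(n) ≥ 2 (π(N/2) − 1)`: the terms are non-negative and each `n = 2p`, `p` an
odd prime `≤ N/2`, contributes `2`. (In fact the sum equals `2 #{n ≤ N : μ(n) = 1} ∼ (6/π²) N`.)
[cite: Ford2004, §1 (after Theorem 1: "global parity bias")] -/
theorem two_mul_primeCounting_sub_one_le_sum (N : ℕ) :
    2 * ((Nat.primeCounting (N / 2) : ℝ) - 1) ≤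
      ∑ n ∈ Ioc 0 N, (1 + (liouville n : ℝ)) * (moebius n : ℝ) := by
  set P := (Nat.primesLE (N / 2)).erase 2 with hP
  have hinj : Set.InjOn (fun p : ℕ => 2 * p) P := fun a _ b _ h => by
    simpa using h
  have hsub : P.image (fun p : ℕ => 2 * p) ⊆ Ioc 0 N := by
    intro n hn
    obtain ⟨p, hp, rfl⟩ := mem_image.mp hn
    have hp' := (Nat.mem_primesLE.mp (mem_erase.mp hp).2)
    rw [mem_Ioc]
    refine ⟨Nat.mul_pos two_pos hp'.2.pos, ?_⟩
    calc 2 * p ≤ 2 * (N / 2) := Nat.mul_le_mul_left 2 hp'.1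
      _ ≤ N := Nat.mul_div_le N 2
  have hcard : (Nat.primeCounting (N / 2) : ℝ) - 1 ≤ (P.card : ℝ) := by
    have h := pred_card_le_card_erase (s := Nat.primesLE (N / 2)) (a := 2)
    rw [Nat.primesLE_card_eq_primeCounting] at h
    have h' : ((Nat.primeCounting (N / 2) - 1 : ℕ) : ℝ) ≤ (P.card : ℝ) := by
      rw [hP]; exact_mod_cast h
    have h1 : (Nat.primeCounting (N / 2) : ℝ) ≤ ((Nat.primeCounting (N / 2) - 1 : ℕ) : ℝ) + 1 := by
      exact_mod_cast le_tsub_add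
    linarith
  calc 2 * ((Nat.primeCounting (N / 2) : ℝ) - 1)
      ≤ 2 * (P.card : ℝ) := by gcongr
    _ = ∑ n ∈ P.image (fun p : ℕ => 2 * p), (2 : ℝ) := by
        rw [sum_const, card_image_of_injOn hinj, nsmul_eq_mul, mul_comm]
    _ = ∑ n ∈ P.image (fun p : ℕ => 2 * p), (1 + (liouville n : ℝ)) * (moebius n : ℝ) := by
        refine sum_congr rfl fun n hn => ?_
        obtain ⟨p, hp, rfl⟩ := mem_image.mp hn
        have hp' := mem_erase.mp hp
        exact (one_add_liouville_mul_moebius_two_mul_prime (Nat.mem_primesLE.mp hp'.2).2 hp'.1).symm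
    _ ≤ ∑ n ∈ Ioc 0 N, (1 + (liouville n : ℝ)) * (moebius n : ℝ) :=
        sum_le_sum_of_subset_of_nonneg hsub fun n _ _ => one_add_liouville_mul_moebius_nonneg n

/-- **Selberg's witness violates Ford's parity condition `(Pcond)`.** Ford's `(Pcond)` asks
`P(x) = ∑_{n ≤ x} a_n μ(n) ≪_B x (log x)^{−B}` for every `B > 0`; for `a_n = 1 + λ(n)` already
`B = 2` fails, since `P(x) ≥ 2 (π(x/2) − 1) ≫ x / log x` (Chebyshev). Thus the Type-I parity
barrier `SelbergParityBarrier` / `no_typeI_prime_lower_bound_allModuli_holds` covers deductions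
from Type-I data ALONE: its witness is removed by the LINEAR Möbius-orthogonality axiom `(Pcond)`
(and a fortiori by Hooley's averaged form `∑_{d ≤ x^α} |∑_{n ≤ x, d ∣ n} μ(n) a_n| ≪_B x (log x)^{−B}`),
so deductions from `R(ν) ∧ (Pcond)` are outside its scope — Ford constructs, for each fixed
`ν < 1`, sequences with `R(ν) ∧ (Pcond)` failing `(S_k)` for all `k ≥ 2` (these satisfy `(S_1)`),
and leaves the case `α + ν > 1` of Hooley's condition open. [cite: Ford2004, §1 (Theorem 2 and the discussion around it)] -/
theorem selbergParity_not_parityCondition :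
    ¬ ∀ B : ℝ, 0 < B →
      (fun x : ℝ => ∑ n ∈ Ioc 0 ⌊x⌋₊, (1 + (liouville n : ℝ)) * (moebius n : ℝ)) =O[atTop]
        fun x : ℝ => x / Real.log x ^ B := by
  intro H
  obtain ⟨C, hC0, hC⟩ := (H 2 two_pos).exists_nonneg
  have h2y : Tendsto (fun y : ℝ => 2 * y) atTop atTop := tendsto_id.const_mul_atTop two_pos
  have hCy := h2y.eventually hC.bound
  -- large `y`: the bound at `x = 2y`, `y ≥ 16`, `log y ≤ (log 2 / 8) y`, `8 C / log 2 ≤ log y`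
  have hl2 : 0 < Real.log 2 := Real.log_pos one_lt_two
  have hlog8 : ∀ᶠ y : ℝ in atTop, Real.log y ≤ Real.log 2 / 8 * y := by
    have := Real.isLittleO_log_id_atTop.bound (div_pos hl2 (by norm_num : (0 : ℝ) < 8))
    filter_upwards [this, eventually_ge_atTop 1] with y hy hy1
    rwa [Real.norm_of_nonneg (Real.log_nonneg hy1), id, Real.norm_of_nonneg (by linarith)] at hy
  have hlogC : ∀ᶠ y : ℝ in atTop, 8 * C / Real.log 2 ≤ Real.log y :=
    Real.tendsto_log_atTop.eventually_ge_atTop _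
  obtain ⟨y, hyC, hy16, hylog, hylogC⟩ :=
    (hCy.and ((eventually_ge_atTop 16).and (hlog8.and hlogC))).exists
  have hy1 : (1 : ℝ) < y := by linarith
  have hlogpos : 0 < Real.log y := Real.log_pos hy1
  -- lower bound at `x = 2y`: `2 (π ⌊y⌋₊ - 1) ≤ P(2y)`
  have hfloor : ⌊2 * y⌋₊ / 2 = ⌊y⌋₊ := by
    rw [← Nat.floor_div_ofNat (2 * y) 2]
    congr 1
    simp
  have hlow := two_mul_primeCounting_sub_one_le_sum ⌊2 * y⌋₊
  rw [hfloor] at hlow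
  -- upper bound at `x = 2y`: `P(2y) ≤ C (2y) / log(2y)^2 ≤ 2 C y / (log y)^2`
  have hup : ∑ n ∈ Ioc 0 ⌊2 * y⌋₊, (1 + (liouville n : ℝ)) * (moebius n : ℝ) ≤
      2 * C * y / Real.log y ^ 2 := by
    have h' := hyC
    have hlog2y : Real.log y ≤ Real.log (2 * y) := Real.log_le_log (by linarith) (by linarith)
    have hlog2ypos : 0 < Real.log (2 * y) := lt_of_lt_of_le hlogpos hlog2y
    rw [Real.norm_of_nonneg (div_nonneg (by linarith) (Real.rpow_nonneg hlog2ypos.le _)),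
      Real.rpow_two] at h'
    refine ((le_abs_self _).trans h').trans ?_
    have key : 2 * y / Real.log (2 * y) ^ 2 ≤ 2 * y / Real.log y ^ 2 :=
      div_le_div_of_nonneg_left (by linarith) (pow_pos hlogpos 2)
        (pow_le_pow_left₀ hlogpos.le hlog2y 2)
    calc C * (2 * y / Real.log (2 * y) ^ 2) ≤ C * (2 * y / Real.log y ^ 2) :=
        mul_le_mul_of_nonneg_left key hC0
      _ = 2 * C * y / Real.log y ^ 2 := by ring
  -- combine with Chebyshev at `y`
  have hcomb : 2 * (((y - 1) * Real.log 2 - Real.log (y + 2)) / Real.log y - 1) ≤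
      2 * C * y / Real.log y ^ 2 := by
    have hπ := Chebyshev.pi_ge' hy1
    have : 2 * (((y - 1) * Real.log 2 - Real.log (y + 2)) / Real.log y - 1) ≤
        2 * ((Nat.primeCounting ⌊y⌋₊ : ℝ) - 1) := by linarith
    exact this.trans (hlow.trans hup)
  -- clear denominators: `(y-1) log 2 - log(y+2) - log y ≤ C y / log y`
  have hcomb' : (y - 1) * Real.log 2 - Real.log (y + 2) - Real.log y ≤ C * y / Real.log y := by
    have h1 : ((y - 1) * Real.log 2 - Real.log (y + 2)) / Real.log y - 1 ≤
        C * y / Real.log y ^ 2 := by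
      have : 2 * C * y / Real.log y ^ 2 = 2 * (C * y / Real.log y ^ 2) := by ring
      rw [this] at hcomb
      linarith
    have h2 := mul_le_mul_of_nonneg_right h1 hlogpos.le
    rw [sub_mul, div_mul_cancel₀ _ hlogpos.ne', one_mul] at h2
    have h3 : C * y / Real.log y ^ 2 * Real.log y = C * y / Real.log y := by
      field_simp
    linarith [h2, h3.le, h3.ge]
  -- `log (y + 2) ≤ log 2 + log y`
  have hlogy2 : Real.log (y + 2) ≤ Real.log 2 + Real.log y := by
    rw [← Real.log_mul two_ne_zero (by linarith : y ≠ 0)]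
    exact Real.log_le_log (by linarith) (by linarith)
  -- `C y / log y ≤ (log 2 / 8) y`
  have hCy' : C * y / Real.log y ≤ Real.log 2 / 8 * y := by
    rw [div_le_iff₀ hlogpos]
    have h4 : 8 * C ≤ Real.log y * Real.log 2 := (div_le_iff₀ hl2).mp hylogC
    have h4y : y * (8 * C) ≤ y * (Real.log y * Real.log 2) :=
      mul_le_mul_of_nonneg_left h4 (by linarith)
    linarith
  have h16 : 16 * Real.log 2 ≤ y * Real.log 2 := mul_le_mul_of_nonneg_right hy16 hl2.le
  nlinarith [hcomb', hlogy2, hCy', hylog, h16, hl2]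

/-- **… and a fortiori Hooley's averaged condition, at every level `α ≥ 0`.** Hooley's hypothesis
`∑_{d ≤ x^α} |∑_{n ≤ x, d ∣ n} μ(n) a_n| ≪_B x (log x)^{−B}` (Ford 2005, display after Theorem 2)
contains the term `d = 1`, which for `a_n = 1 + λ(n)` is `P(x) ≥ 0`; so it fails for Selberg's
witness for every `α ≥ 0` (Ford's own fixed-level sequences satisfy it for `α < 1 − ν`; "The case
`α + ν > 1` remains open"). [cite: Ford2004, §1 (discussion after Theorem 2)] -/
theorem selbergParity_not_hooleyCondition {α : ℝ} (hα : 0 ≤ α) :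
    ¬ ∀ B : ℝ, 0 < B →
      (fun x : ℝ => ∑ d ∈ Icc 1 ⌊x ^ α⌋₊,
          |∑ n ∈ (Ioc 0 ⌊x⌋₊).filter (d ∣ ·), (1 + (liouville n : ℝ)) * (moebius n : ℝ)|) =O[atTop]
        fun x : ℝ => x / Real.log x ^ B := by
  intro H
  refine selbergParity_not_parityCondition fun B hB => IsBigO.trans ?_ (H B hB)
  refine IsBigO.of_bound 1 ?_
  filter_upwards [eventually_ge_atTop (1 : ℝ)] with x hx
  have hP : 0 ≤ ∑ n ∈ Ioc 0 ⌊x⌋₊, (1 + (liouville n : ℝ)) * (moebius n : ℝ) :=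
    sum_nonneg fun n _ => one_add_liouville_mul_moebius_nonneg n
  have h1 : 1 ∈ Icc 1 ⌊x ^ α⌋₊ := by
    rw [mem_Icc]
    exact ⟨le_rfl, Nat.le_floor (by exact_mod_cast Real.one_le_rpow hx hα)⟩
  have hfilter : (Ioc 0 ⌊x⌋₊).filter ((1 : ℕ) ∣ ·) = Ioc 0 ⌊x⌋₊ :=
    filter_true_of_mem fun n _ => one_dvd n
  rw [one_mul, Real.norm_of_nonneg hP, Real.norm_of_nonneg (sum_nonneg fun d _ => abs_nonneg _)]
  refine le_trans ?_ (single_le_sum (f := fun d => |∑ n ∈ (Ioc 0 ⌊x⌋₊).filter (d ∣ ·),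
    (1 + (liouville n : ℝ)) * (moebius n : ℝ)|) (fun d _ => abs_nonneg _) h1)
  simp only [hfilter]
  exact le_abs_self _


end Literature.Barriers.Parity
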